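import Literature.AnabelianGeometry.SemiGraphs.CharacteristicOpenCore
import Literature.AnabelianGeometry.Anabelioids.BasicProofs
import HarnessLib

/-!
# Continuous finite `G`-sets of bounded size: finitely many up to isomorphism ([SemiAnbd] Prop 5.2 (i))

Mochizuki, *Semi-graphs of anabelioids*, Publ. RIMS **42** (2006), §5 Prop. 5.2 (i) p. 63 and its proof
p. 64 ("Assertions (i), (ii) follow from the various finiteness assumptions in our definition of a
'continuous action' [cf. Definition 5.1, (i); the fact that `G` is coherent]"); Def. 2.3 (iii) p. 25
("coherent": the constituent anabelioids have topologically finitely generated fundamental groups).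
[cite: MochizukiSemiAnbd2006, Prop 5.2 (i), p. 63]

abc-iut cell, layer L3, row **T54·E1b** of `HOME/plan/GAP-LEDGER.md` G-w4d053-1 (seat abc-iut-w4-d048
gen 3): the FINITENESS input `hfin : (openSubgroupsIndexLE Γ d).Finite` of abc-iut-w4-d053's
characteristic open cores (`CharacteristicOpenCore.lean`) at the group of the Galois tower.  This file is
the LOCAL half, for ONE topological group `G` (a vertex or edge group `Π_v`, `Π_e`): granted `hfin` for
`G` (e.g. `G` topologically finitely generated, `openSubgroupsIndexLE_finite_of_isTopologicallyFinitelyGenerated`),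

* `BoundedGSets.rep hfin i` (`i : RepIndex G d`, a FINITE type, `finite_repIndex`) — representatives:
  the permutation representations of `G` on `Fin k`, `k ≤ d`, killing `charOpenCore G d` (continuous
  because that core is open), as objects of `B(G) = ContAction FintypeCat G`;
* `BoundedGSets.exists_iso_rep` — **every continuous finite `G`-set with at most `d` points is
  isomorphic in `B(G)` to some representative** (its stabilisers are open of index `≤ d`, hence contain
  the core: `stabilizer_mem_openSubgroupsIndexLE`, `smul_eq_of_mem_charOpenCore`);
* `BoundedGSets.finite_hom` / `finite_iso` — morphisms / isomorphisms between two objects of `B(H)` form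
  a finite set.

The GLOBAL half (objects of `B(𝒢)` over a finite semi-graph, and the open subgroups of bounded index of
`π̂₁(𝒢) = Aut(fiberAt v₀)`) is `BoundedDegreeCoveringsFinite.lean`.  Classical finite group-set
bookkeeping (Dixon–du Sautoy–Mann–Segal, *Analytic pro-p groups*, Prop. 1.6 [cite: DixonEtAl1999, Prop 1.6]);
plumbing definitions only (`RepIndex`, `repAction`, `repActionObj`, `rep`, `repIndexOf`), no `Prop` fact,
no instance, no notation.  Nothing here refers to the IUT corpus; no side taken on [IUTchIII] Cor 3.12.
-/

namespace Literature.AnabelianGeometry.SemiGraphs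

open CategoryTheory Literature.AnabelianGeometry.Anabelioids
open Literature.AlgebraicGeometry.Frobenioids (BCat)
open scoped FintypeCatDiscrete

universe u

/-! ### Finite continuous `G`-sets of bounded size: a finite family of representatives -/

namespace BoundedGSets

variable (G : Type u) [Group G] [TopologicalSpace G] [IsTopologicalGroup G]

/-- Index of the representatives of continuous finite `G`-sets of size `≤ d`: a size `k ≤ d` and a
permutation representation of `G` on `Fin k` that kills the characteristic open core
`charOpenCore G d`. [cite: MochizukiSemiAnbd2006, Prop 5.2 (i), p. 63] -/
def RepIndex (d : ℕ) : Type u :=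
  Σ k : Fin (d + 1), {f : G →* Equiv.Perm (ULift.{u} (Fin k)) // charOpenCore G d ≤ f.ker}

variable {G}

/-- With finitely many open subgroups of index `≤ d`, the index type of representatives is finite
(such representations factor through the finite quotient `G ⧸ charOpenCore G d`).
[cite: MochizukiSemiAnbd2006, Prop 5.2 (i), p. 63] -/
theorem finite_repIndex {d : ℕ} (hfin : (openSubgroupsIndexLE G d).Finite) :
    Finite (RepIndex G d) := by
  haveI : (charOpenCore G d).Normal := charOpenCore_normal d
  haveI : (charOpenCore G d).FiniteIndex := ⟨charOpenCore_index_ne_zero hfin⟩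
  haveI : Finite (G ⧸ charOpenCore G d) := Subgroup.finite_quotient_of_finiteIndex
  haveI : ∀ k : Fin (d + 1),
      Finite {f : G →* Equiv.Perm (ULift.{u} (Fin k)) // charOpenCore G d ≤ f.ker} := fun k => by
    refine Finite.of_injective
      (fun f => (QuotientGroup.lift (charOpenCore G d) f.1 f.2 :
        G ⧸ charOpenCore G d → Equiv.Perm (ULift.{u} (Fin k)))) ?_
    intro f f' h
    apply Subtype.ext
    ext g : 1
    have := congrFun h (g : G ⧸ charOpenCore G d)
    simpa only [QuotientGroup.lift_mk] using this
  unfold RepIndex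
  infer_instance

/-- The `G`-action on `Fin k` attached to an index. [cite: MochizukiSemiAnbd2006, Prop 5.2 (i), p. 63] -/
abbrev repAction {d : ℕ} (i : RepIndex G d) : MulAction G (ULift.{u} (Fin i.1)) :=
  MulAction.compHom _ i.2.1

/-- The representative finite `G`-set (as an `Action`). [cite: MochizukiSemiAnbd2006, Prop 5.2 (i), p. 63] -/
noncomputable def repActionObj {d : ℕ} (i : RepIndex G d) : Action FintypeCat.{u} G :=
  letI := repAction i
  Action.FintypeCat.ofMulAction G (FintypeCat.of (ULift.{u} (Fin i.1)))

omit [IsTopologicalGroup G] in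
/-- Every stabiliser of the representative action contains `charOpenCore G d`.
[cite: MochizukiSemiAnbd2006, Prop 5.2 (i), p. 63] -/
theorem charOpenCore_le_stabilizer_rep {d : ℕ} (i : RepIndex G d) (x : (repActionObj i).V) :
    charOpenCore G d ≤ MulAction.stabilizer G x := by
  intro g hg
  rw [MulAction.mem_stabilizer_iff]
  have hq : i.2.1 g = 1 := i.2.2 hg
  letI : MulAction G (ULift.{u} (Fin i.1)) := repAction i
  have key : (i.2.1 g) • (show ULift.{u} (Fin i.1) from x) = (show ULift.{u} (Fin i.1) from x) := by
    rw [hq, one_smul]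
  exact key

/-- The representative action is continuous when `charOpenCore G d` is open (finitely many open
subgroups of index `≤ d`). [cite: MochizukiSemiAnbd2006, Prop 5.2 (i), p. 63] -/
theorem isContinuous_repActionObj {d : ℕ} (hfin : (openSubgroupsIndexLE G d).Finite)
    (i : RepIndex G d) : Action.IsContinuous (repActionObj i) := by
  rw [isContinuous_iff_stabilizer_isOpen]
  intro x
  exact Subgroup.isOpen_mono (charOpenCore_le_stabilizer_rep i x) (isOpen_charOpenCore hfin)

/-- **The representatives**: the continuous finite `G`-sets `rep hfin i`, `i : RepIndex G d`.
[cite: MochizukiSemiAnbd2006, Prop 5.2 (i), p. 63] -/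
noncomputable def rep {d : ℕ} (hfin : (openSubgroupsIndexLE G d).Finite) (i : RepIndex G d) :
    BCat G :=
  ⟨repActionObj i, isContinuous_repActionObj hfin i⟩

/-- Stabilisers of points of a continuous finite `G`-set of size `≤ d` are open of index in `[1, d]`.
[cite: MochizukiSemiAnbd2006, Prop 5.2 (i), p. 63] -/
theorem stabilizer_mem_openSubgroupsIndexLE {d : ℕ} (X : BCat G) (hX : Nat.card X.obj.V ≤ d)
    (x : X.obj.V) : MulAction.stabilizer G x ∈ openSubgroupsIndexLE G d := by
  refine ⟨(isContinuous_iff_stabilizer_isOpen X.obj).mp X.property x, ?_, ?_⟩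
  · rw [MulAction.index_stabilizer]
    exact (MulAction.nonempty_orbit x).ncard_pos
  · rw [MulAction.index_stabilizer]
    exact (Set.ncard_le_card _).trans hX

/-- `charOpenCore G d` acts trivially on every continuous finite `G`-set of size `≤ d`.
[cite: MochizukiSemiAnbd2006, Prop 5.2 (i), p. 63] -/
theorem smul_eq_of_mem_charOpenCore {d : ℕ} (X : BCat G) (hX : Nat.card X.obj.V ≤ d)
    {g : G} (hg : g ∈ charOpenCore G d) (x : X.obj.V) : g • x = x :=
  MulAction.mem_stabilizer_iff.mp (charOpenCore_le (stabilizer_mem_openSubgroupsIndexLE X hX x) hg)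

/-- The permutation representation of a continuous finite `G`-set of size `≤ d`, transported along a
bijection, kills `charOpenCore G d`. [cite: MochizukiSemiAnbd2006, Prop 5.2 (i), p. 63] -/
theorem charOpenCore_le_ker_permRep {d : ℕ} (X : BCat G) (hX : Nat.card X.obj.V ≤ d)
    {Y : Type u} (e : X.obj.V ≃ Y) :
    charOpenCore G d ≤ ((e.permCongrHom.toMonoidHom).comp (MulAction.toPermHom G X.obj.V)).ker := by
  intro g hg
  rw [MonoidHom.mem_ker, MonoidHom.comp_apply]
  have h1 : MulAction.toPermHom G X.obj.V g = 1 := by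
    ext x
    rw [MulAction.toPermHom_apply, MulAction.toPerm_apply, Equiv.Perm.one_apply]
    exact smul_eq_of_mem_charOpenCore X hX hg x
  rw [h1]
  exact map_one _

/-- The index of the representative of `X`. [cite: MochizukiSemiAnbd2006, Prop 5.2 (i), p. 63] -/
noncomputable def repIndexOf {d : ℕ} (X : BCat G) (hX : Nat.card X.obj.V ≤ d) : RepIndex G d :=
  ⟨⟨Nat.card X.obj.V, Nat.lt_succ_of_le hX⟩,
    ⟨((Finite.equivFin X.obj.V).trans Equiv.ulift.symm).permCongrHom.toMonoidHom.comp
        (MulAction.toPermHom G X.obj.V),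
      charOpenCore_le_ker_permRep X hX _⟩⟩

/-- **Normal form**: every continuous finite `G`-set of size `≤ d` is isomorphic to a representative.
[cite: MochizukiSemiAnbd2006, Prop 5.2 (i), p. 63] -/
theorem exists_iso_rep {d : ℕ} (hfin : (openSubgroupsIndexLE G d).Finite) (X : BCat G)
    (hX : Nat.card X.obj.V ≤ d) : ∃ i : RepIndex G d, Nonempty (X ≅ rep hfin i) := by
  let e : X.obj.V ≃ ULift.{u} (Fin (Nat.card X.obj.V)) :=
    (Finite.equivFin X.obj.V).trans Equiv.ulift.symm
  refine ⟨repIndexOf X hX, ⟨ObjectProperty.isoMk _ (Action.mkIso (FintypeCat.equivEquivIso e) ?_)⟩⟩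
  intro g
  ext x
  letI : MulAction G (ULift.{u} (Fin (Nat.card X.obj.V))) := repAction (repIndexOf X hX)
  change e (g • x) =
    ((e.permCongrHom.toMonoidHom).comp (MulAction.toPermHom G X.obj.V) g) • e x
  rw [MonoidHom.comp_apply, Equiv.Perm.smul_def]
  change e (g • x) = e (MulAction.toPermHom G X.obj.V g (e.symm (e x)))
  rw [Equiv.symm_apply_apply, MulAction.toPermHom_apply, MulAction.toPerm_apply]

end BoundedGSets

/-! ### Isomorphisms of `B(H)` form a finite set -/

namespace BoundedGSets

variable {H : Type u} [Group H] [TopologicalSpace H]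

/-- Morphisms between two continuous finite `H`-sets form a finite set.
[cite: MochizukiSemiAnbd2006, Prop 5.2 (i), p. 63] -/
theorem finite_hom (A B : BCat H) : Finite (A ⟶ B) := by
  refine Finite.of_injective (fun f : A ⟶ B => fun x : A.obj.V => (f.hom.hom x : B.obj.V)) ?_
  intro f g hfg
  apply ObjectProperty.hom_ext
  apply Action.Hom.ext
  exact ConcreteCategory.hom_ext _ _ fun x => congrFun hfg x

/-- Isomorphisms between two continuous finite `H`-sets form a finite set.
[cite: MochizukiSemiAnbd2006, Prop 5.2 (i), p. 63] -/
theorem finite_iso (A B : BCat H) : Finite (A ≅ B) :=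
  haveI := finite_hom A B
  Finite.of_injective Iso.hom fun _ _ h => Iso.ext h

end BoundedGSets


end Literature.AnabelianGeometry.SemiGraphs
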